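import Literature.MathematicalPhysics.QuantumFieldTheory.Balaban1983to89.B5Prop11Plancherel

/-!
# `Balaban1983to89.B5Eq129FreeResolventCycleProfile` — T. Bałaban, *Propagators and renormalization transformations for lattice gauge
# theories. I*, Commun. Math. Phys. **95** (1984) 17–40 [Balaban1984PropagatorsI] (1.29) p. 23 (the free lattice operators on the finite torus; here
# d = 1): **THE FREE RESOLVENT ON THE CYCLE `ℤ∕n` IN CLOSED FORM (method of images) AND THE TOTAL VARIATION OF ITS PROFILE —
# `φ(s) = q(q^s + q^{n−s})∕(t²(1−q²)(1−qⁿ))`, `Σ_s|φ(s−1) − φ(s)| = (2q∕(t²(1−q²)))·(1−q^M)(1−q^{M′})∕(1−qⁿ) ≤ 2∕√(m² + 4mt²)`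
# (`n = M + M′`, `M ≤ M′ ≤ M+1`, `q ∈ (0,1)` the root of `q + q⁻¹ = 2 + m∕t²`)** — third of three files typing the (K∇) letter VALUE of the pub-balaban
# NE9 chain's storey J (row L13; P-J-1 of `t4-ne9-idea-1` g121∕g122, whose scratch certified the abstract pieces D(0)∕D(i)(ii)∕C; here the cycle
# bookkeeping is certified too); capstone `B5Eq129FreeResolventGradientRow`

statement-level skeleton of published theorems with citation tags; proofs where landed; nothing here is a claim about the Yang–Mills mass gap

CITATION HEADER (lean-in-tree rule).  Audit cell `pub-balaban`, sub-cell `t4`, BINDER row NE9; filed by NE9 crux-team LEAF PROVER 05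
(`b2b-balaban-t4-ne9-formalise-leaf-05`, gen 80).  OBJECT: the d = 1 case of [Balaban1984PropagatorsI] (1.29) p. 23's free stencil, written on
Mathlib's `ZMod n` with the resolvent equation `t²[(φ(s) − φ(s−1)) + (φ(s) − φ(s+1))] + m·φ(s) = δ_{s,0}` as a HYPOTHESIS (no `def`).  CONTENT:
[folklore] (second-order linear recurrence on a cycle; telescoping of a V-shaped sequence; the quadratic `q² − (2 + m∕t²)q + 1 = 0`).  Independent
of the two torus files (imports `B5Prop11Plancherel` only, for the directory's Mathlib closure).  Nothing of [B5′] is asserted.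

WHAT IS PROVED (sorry-free; proof lane — 0 `def`).
* §1 `cycle_eq_of_resolvent_eq` (uniqueness, minimum principle); §2 **`exists_root`** (`∃ q ∈ (0,1)`, `q + q⁻¹ = 2 + m∕t²`), **`root_const_eq`**
  (`2q∕(t²(1−q²)) = 2∕√(m²+4mt²)`); §3 `closedForm_resolvent`, **`cycle_profile_eq`** (the solution IS `q(q^s + q^{n−s})∕(t²(1−q²)(1−qⁿ))`, `2 ≤ n`);
  §4 **`sum_abs_sub_eq`** (the total variation in closed form), **`sum_abs_sub_le`** (`≤ 2∕√(m² + 4mt²)`, uniformly in `n`; `q`-free statement).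
HONEST SCOPE.  Elementary; `n ≥ 2` (the one-point cycle is degenerate and excluded); the `ℕ`-subtraction `n − s.val` in the closed form is exact
(`s.val < n`).  ONE letter of ONE un-opened storey of row L13; NOT the ∇-line of (3.42), NOT Tier P, NOT NE9 (cell pub-balaban: NE9 NOT PRINTED ∕ NOT
PROVED; «NE9 ⇐ the named binders»; row WALLED ON A MODEL (O-NE9-1; #5 UNRULED); spine PROVED 0∕9; rung (B)+1 finite T⁴ — NOT infinite volume, NOT mass
gap, NOT BetaPertH, NOT Clay).  HONEST DEPENDENCY: continuum YM on T⁴ ⇐ BetaPertH ∧ nine spine estimates (0/9 proved); BetaPertH ⇐ (D1) ∧ (D4) ∧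
CAP+tail; G-an2-4 gates asym, D1 and NE2/3/4.  NEW file; nothing modified.  Net new unproved facts: 0.
-/

noncomputable section

open scoped BigOperators

namespace Literature.MathematicalPhysics.QuantumFieldTheory.Balaban1983to89.B5Eq129FreeResolventCycleProfile

variable {n : ℕ} [NeZero n]

/-! ## §1 Uniqueness for the resolvent equation on the cycle `ℤ∕n` -/

/-- minimum principle on the cycle: a solution of the HOMOGENEOUS equation `t²[(w(s) − w(s−1)) + (w(s) − w(s+1))] + m·w(s) = 0`, `m > 0`,
is nonnegative (look at a minimiser). [folklore] -/
private theorem cycle_nonneg_of_homogeneous (t : ℝ) {m : ℝ} (hm : 0 < m) {w : ZMod n → ℝ}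
    (h : ∀ s, t ^ 2 * ((w s - w (s - 1)) + (w s - w (s + 1))) + m * w s = 0) (s : ZMod n) : 0 ≤ w s := by
  obtain ⟨s₀, -, hmin⟩ := Finset.exists_min_image Finset.univ w (Finset.univ_nonempty (α := ZMod n))
  have h1 := hmin (s₀ - 1) (Finset.mem_univ _)
  have h2 := hmin (s₀ + 1) (Finset.mem_univ _)
  have hbr : t ^ 2 * ((w s₀ - w (s₀ - 1)) + (w s₀ - w (s₀ + 1))) ≤ 0 :=
    mul_nonpos_iff.mpr (Or.inl ⟨sq_nonneg t, by linarith⟩)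
  have h0 : 0 ≤ w s₀ := by
    by_contra hneg
    have : m * w s₀ < 0 := mul_neg_of_pos_of_neg hm (lt_of_not_ge hneg)
    linarith [h s₀]
  exact h0.trans (hmin s (Finset.mem_univ _))

/-- **UNIQUENESS on the cycle**: two solutions of `t²[(φ(s) − φ(s−1)) + (φ(s) − φ(s+1))] + m·φ(s) = ψ(s)` (`m > 0`) coincide.
[cite: Balaban1984PropagatorsI, (1.29) p.23] -/
theorem cycle_eq_of_resolvent_eq (t : ℝ) {m : ℝ} (hm : 0 < m) {φ₁ φ₂ ψ : ZMod n → ℝ}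
    (h₁ : ∀ s, t ^ 2 * ((φ₁ s - φ₁ (s - 1)) + (φ₁ s - φ₁ (s + 1))) + m * φ₁ s = ψ s)
    (h₂ : ∀ s, t ^ 2 * ((φ₂ s - φ₂ (s - 1)) + (φ₂ s - φ₂ (s + 1))) + m * φ₂ s = ψ s) : φ₁ = φ₂ := by
  have ha : ∀ s, 0 ≤ φ₁ s - φ₂ s :=
    cycle_nonneg_of_homogeneous t hm (w := fun s => φ₁ s - φ₂ s) fun s => by linear_combination h₁ s - h₂ s
  have hb : ∀ s, 0 ≤ φ₂ s - φ₁ s :=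
    cycle_nonneg_of_homogeneous t hm (w := fun s => φ₂ s - φ₁ s) fun s => by linear_combination h₂ s - h₁ s
  funext s; linarith [ha s, hb s]

/-! ## §2 The characteristic root `q ∈ (0,1)`, `q + q⁻¹ = 2 + m∕t²`, and its constants -/

/-- **EXISTENCE OF THE ROOT**: for `t ≠ 0`, `m > 0` the equation `q + q⁻¹ = 2 + m∕t²` has a root in `(0,1)`
(`q = ((2+h) − √(h²+4h))∕2`, `h = m∕t²`). [folklore] lattice analysis [cite: Balaban1984PropagatorsI, (1.29) p.23] -/
theorem exists_root (t : ℝ) (ht : t ≠ 0) {m : ℝ} (hm : 0 < m) : ∃ q : ℝ, 0 < q ∧ q < 1 ∧ q + q⁻¹ = 2 + m / t ^ 2 := by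
  have ht2 : 0 < t ^ 2 := by positivity
  set h : ℝ := m / t ^ 2 with hh
  have hpos : 0 < h := div_pos hm ht2
  have hdisc : 0 ≤ h ^ 2 + 4 * h := by positivity
  set r : ℝ := Real.sqrt (h ^ 2 + 4 * h) with hr
  have hr2 : r ^ 2 = h ^ 2 + 4 * h := Real.sq_sqrt hdisc
  have hr0 : 0 ≤ r := Real.sqrt_nonneg _
  have hrlt : r < 2 + h := by nlinarith
  have hrgt : h < r := by nlinarith
  refine ⟨((2 + h) - r) / 2, by linarith, by linarith, ?_⟩
  have hprod : ((2 + h) - r) / 2 * (((2 + h) + r) / 2) = 1 := by linear_combination (-1 / 4 : ℝ) * hr2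
  rw [inv_eq_of_mul_eq_one_right hprod]
  ring

/-- the root's polynomial relation `m·q = t²(q − 1)²`. [folklore] -/
private theorem root_mq (t : ℝ) (ht : t ≠ 0) (m : ℝ) {q : ℝ} (hq0 : 0 < q) (hq : q + q⁻¹ = 2 + m / t ^ 2) :
    m * q = t ^ 2 * (q ^ 2 + 1 - 2 * q) := by
  have hqinv : q⁻¹ = 2 + m / t ^ 2 - q := by linarith [hq]
  have key : q * (2 + m / t ^ 2 - q) = 1 := by rw [← hqinv]; exact mul_inv_cancel₀ hq0.ne'
  have h3 : q * (m / t ^ 2) = q ^ 2 + 1 - 2 * q := by linear_combination key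
  have h4 : t ^ 2 * (q * (m / t ^ 2)) = m * q := by field_simp
  rw [← h4, h3]

/-- the algebra of the root: `t²(1 − q²) = q·√(m² + 4mt²)`. [folklore] -/
private theorem root_algebra (t : ℝ) (ht : t ≠ 0) {m : ℝ} (hm : 0 < m) {q : ℝ} (hq0 : 0 < q) (hq1 : q < 1)
    (hq : q + q⁻¹ = 2 + m / t ^ 2) : t ^ 2 * (1 - q ^ 2) = q * Real.sqrt (m ^ 2 + 4 * m * t ^ 2) := by
  have ht2 : 0 < t ^ 2 := by positivity
  have hmq := root_mq t ht m hq0 hq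
  -- `(t²(q⁻¹ − q))² = m² + 4mt²`, i.e. `(t²(1 − q²))² = q²(m² + 4mt²)`
  have hsq : (t ^ 2 * (1 - q ^ 2)) ^ 2 = (q * Real.sqrt (m ^ 2 + 4 * m * t ^ 2)) ^ 2 := by
    rw [mul_pow q, Real.sq_sqrt (by positivity)]
    linear_combination (-(m * q + t ^ 2 * (1 + q) ^ 2)) * hmq
  have hl : 0 ≤ t ^ 2 * (1 - q ^ 2) := by
    apply mul_nonneg ht2.le; nlinarith
  have hr : 0 ≤ q * Real.sqrt (m ^ 2 + 4 * m * t ^ 2) := mul_nonneg hq0.le (Real.sqrt_nonneg _)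
  exact (pow_left_inj₀ hl hr two_ne_zero).1 hsq

/-- **THE CONSTANT OF THE ∇-ROW**: `2q∕(t²(1 − q²)) = 2∕√(m² + 4mt²)` for the root `q`. [folklore] [cite: Balaban1984PropagatorsI, (1.29) p.23] -/
theorem root_const_eq (t : ℝ) (ht : t ≠ 0) {m : ℝ} (hm : 0 < m) {q : ℝ} (hq0 : 0 < q) (hq1 : q < 1)
    (hq : q + q⁻¹ = 2 + m / t ^ 2) : 2 * q / (t ^ 2 * (1 - q ^ 2)) = 2 / Real.sqrt (m ^ 2 + 4 * m * t ^ 2) := by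
  have hs : 0 < Real.sqrt (m ^ 2 + 4 * m * t ^ 2) := Real.sqrt_pos.2 (by positivity)
  rw [root_algebra t ht hm hq0 hq1 hq]
  field_simp

/-! ## §3 The closed-form profile `α(q^s + q^{n−s})` solves the cycle equation; hence it IS the solution -/

omit [NeZero n] in
/-- exponent bookkeeping on the cycle: with `n = i + k + 2` (`i = j − 1`, `k = n − 1 − j` for a row `1 ≤ j ≤ n − 1`) the mirrored
powers around `j` are `q^{n−i} = q²·q^k`, `q^{n−(i+1)} = q·q^k`, `q^{n−(i+2)} = q^k`. [folklore] -/
private theorem pow_around (q : ℝ) {i k : ℕ} (h : n = i + k + 2) :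
    q ^ (n - i) = q ^ 2 * q ^ k ∧ q ^ (n - (i + 1)) = q * q ^ k ∧ q ^ (n - (i + 2)) = q ^ k := by
  refine ⟨?_, ?_, ?_⟩
  · rw [show n - i = k + 2 by omega, pow_add]; ring
  · rw [show n - (i + 1) = k + 1 by omega, pow_succ]; ring
  · rw [show n - (i + 2) = k by omega]

/-- **THE CLOSED-FORM PROFILE SOLVES THE CYCLE EQUATION** (`2 ≤ n`, `t ≠ 0`, `q ∈ (0,1)` the root): with
`α = q ∕ (t²(1 − q²)(1 − qⁿ))`, `g(s) = α(q^{s} + q^{n−s})` (`s` read in `[0, n)`) satisfies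
`t²[(g(s) − g(s−1)) + (g(s) − g(s+1))] + m·g(s) = δ_{s,0}`. [folklore] [cite: Balaban1984PropagatorsI, (1.29) p.23] -/
theorem closedForm_resolvent (hn : 2 ≤ n) (t : ℝ) (ht : t ≠ 0) (m : ℝ) {q : ℝ} (hq0 : 0 < q) (hq1 : q < 1)
    (hq : q + q⁻¹ = 2 + m / t ^ 2) (s : ZMod n) :
    t ^ 2 * ((q / (t ^ 2 * (1 - q ^ 2) * (1 - q ^ n)) * (q ^ s.val + q ^ (n - s.val)) -
        q / (t ^ 2 * (1 - q ^ 2) * (1 - q ^ n)) * (q ^ (s - 1).val + q ^ (n - (s - 1).val))) +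
      (q / (t ^ 2 * (1 - q ^ 2) * (1 - q ^ n)) * (q ^ s.val + q ^ (n - s.val)) -
        q / (t ^ 2 * (1 - q ^ 2) * (1 - q ^ n)) * (q ^ (s + 1).val + q ^ (n - (s + 1).val)))) +
      m * (q / (t ^ 2 * (1 - q ^ 2) * (1 - q ^ n)) * (q ^ s.val + q ^ (n - s.val))) = if s = 0 then 1 else 0 := by
  haveI : Fact (1 < n) := ⟨by omega⟩
  have hval1 : (1 : ZMod n).val = 1 := ZMod.val_one _
  have ht2 : 0 < t ^ 2 := by positivity
  have hmq := root_mq t ht m hq0 hq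
  have hq2 : 0 < 1 - q ^ 2 := by nlinarith
  have hqn : 0 < 1 - q ^ n := by have := pow_lt_one₀ hq0.le hq1 (by omega : n ≠ 0); linarith
  set α : ℝ := q / (t ^ 2 * (1 - q ^ 2) * (1 - q ^ n)) with hαdef
  have hα : α * (t ^ 2 * (1 - q ^ 2) * (1 - q ^ n)) = q := div_mul_cancel₀ _ (by positivity)
  by_cases hs : s = 0
  · -- the source row
    subst hs
    rw [if_pos rfl]
    have hm1 : ((0 : ZMod n) - 1).val = n - 1 := by
      rw [zero_sub, ZMod.neg_val, if_neg (by exact one_ne_zero), hval1]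
    have hp1 : ((0 : ZMod n) + 1).val = 1 := by rw [zero_add, hval1]
    rw [ZMod.val_zero, hm1, hp1, show n - (n - 1) = 1 by omega, Nat.sub_zero, pow_zero, pow_one]
    -- with `c = q^{n-1}`, `qⁿ = q·c`
    have hc : q ^ n = q * q ^ (n - 1) := by rw [← pow_succ', show n - 1 + 1 = n by omega]
    rw [hc]
    set c : ℝ := q ^ (n - 1)
    have hαc : α * (t ^ 2 * (1 - q ^ 2) * (1 - q * c)) = q := by rw [← hc]; exact hα
    have key : q * (t ^ 2 * ((α * (1 + q * c) - α * (c + q)) + (α * (1 + q * c) - α * (q + c))) + m * (α * (1 + q * c))) = q * 1 := by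
      linear_combination hαc + α * (1 + q * c) * hmq
    exact mul_left_cancel₀ hq0.ne' key
  · -- a generic row `j = i + 1 ∈ [1, n − 1]`, `n = i + k + 2`
    rw [if_neg hs]
    have hj1 : 1 ≤ s.val := by
      rcases Nat.eq_zero_or_pos s.val with h0 | h0
      · exact absurd ((ZMod.val_eq_zero s).1 h0) hs
      · exact h0
    have hjn : s.val ≤ n - 1 := by have := ZMod.val_lt s; omega
    obtain ⟨i, hi⟩ : ∃ i, s.val = i + 1 := ⟨s.val - 1, by omega⟩
    obtain ⟨k, hk⟩ : ∃ k, n = i + k + 2 := ⟨n - 1 - s.val, by omega⟩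
    obtain ⟨e0, e1, e2⟩ := pow_around (n := n) q hk
    have hm1 : (s - 1).val = i := by rw [ZMod.val_sub (by rw [hval1]; exact hj1), hval1]; omega
    -- the forward neighbour: `i + 2 < n`, or the wrap `i + 2 = n` (then `s + 1 = 0`, and `q⁰ + qⁿ = q²qⁱ + qᵏ` all the same)
    have hp : q ^ (s + 1).val + q ^ (n - (s + 1).val) = q ^ 2 * q ^ i + q ^ k := by
      by_cases hlt : s.val + 1 < n
      · rw [ZMod.val_add_of_lt (by rwa [hval1]), hval1, hi, e2]; ring
      · have hk0 : k = 0 := by omega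
        have hs1 : s + 1 = 0 := by
          have : s = ((n - 1 : ℕ) : ZMod n) := by rw [← ZMod.natCast_zmod_val s]; congr 1; omega
          rw [this, ← Nat.cast_succ, show (n - 1).succ = n by omega, ZMod.natCast_self]
        rw [hs1, ZMod.val_zero, pow_zero, Nat.sub_zero, hk, hk0]; ring
    rw [hm1, hi, hp, e0, e1]
    set a : ℝ := q ^ i
    set b : ℝ := q ^ k
    linear_combination (α * (a + b)) * hmq

/-- **THE CYCLE RESOLVENT IN CLOSED FORM**: for `2 ≤ n`, `t ≠ 0`, `m > 0` and `q ∈ (0,1)` with `q + q⁻¹ = 2 + m∕t²`, the unique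
solution of `t²[(φ(s) − φ(s−1)) + (φ(s) − φ(s+1))] + m·φ(s) = δ_{s,0}` on `ℤ∕n` is `φ(s) = q(q^{s} + q^{n−s})∕(t²(1−q²)(1−qⁿ))`
(`s ∈ [0,n)`) — the method of images on the cycle. [folklore] [cite: Balaban1984PropagatorsI, (1.29) p.23] -/
theorem cycle_profile_eq (hn : 2 ≤ n) (t : ℝ) (ht : t ≠ 0) {m : ℝ} (hm : 0 < m) {q : ℝ} (hq0 : 0 < q) (hq1 : q < 1)
    (hq : q + q⁻¹ = 2 + m / t ^ 2) {φ : ZMod n → ℝ}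
    (hφ : ∀ s, t ^ 2 * ((φ s - φ (s - 1)) + (φ s - φ (s + 1))) + m * φ s = if s = 0 then 1 else 0) (s : ZMod n) :
    φ s = q / (t ^ 2 * (1 - q ^ 2) * (1 - q ^ n)) * (q ^ s.val + q ^ (n - s.val)) := by
  have h := cycle_eq_of_resolvent_eq t hm hφ
    (φ₂ := fun s => q / (t ^ 2 * (1 - q ^ 2) * (1 - q ^ n)) * (q ^ s.val + q ^ (n - s.val)))
    (fun s => closedForm_resolvent hn t ht m hq0 hq1 hq s)
  exact congrFun h s

/-! ## §4 Total variation of the profile: closed form and the universal bound `2∕√(m² + 4mt²)` -/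

/-- reindex the cycle by `[0, n)` through `s = j + 1`. [folklore] -/
private theorem sum_cycle_eq_sum_range (F : ZMod n → ℝ) :
    ∑ s : ZMod n, F s = ∑ j ∈ Finset.range n, F ((j : ZMod n) + 1) := by
  refine Finset.sum_nbij' (fun s => (s - 1).val) (fun j => (j : ZMod n) + 1) ?_ ?_ ?_ ?_ ?_
  · intro s _; exact Finset.mem_range.2 (ZMod.val_lt _)
  · intro j _; exact Finset.mem_univ _
  · intro s _; simp only [ZMod.natCast_zmod_val, sub_add_cancel]
  · intro j hj
    rw [Finset.mem_range] at hj
    simp only [add_sub_cancel_right, ZMod.val_natCast, Nat.mod_eq_of_lt hj]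
  · intro s _; simp only [ZMod.natCast_zmod_val, sub_add_cancel]

omit [NeZero n] in
/-- the total variation over one period of the V-shaped sequence `G(j) = α(q^j + q^{n−j})` (`α ≥ 0`, `0 ≤ q ≤ 1`, `n = M + M′`,
`M ≤ M′ ≤ M + 1`): descending on `[0, M]`, ascending on `[M, n]`, `G(n) = G(0)`, so `Σ_{j<n} |G(j) − G(j+1)| = 2(G(0) − G(M))
= 2α(1 − q^M)(1 − q^{M′})`. [folklore] -/
private theorem tv_range (α q : ℝ) (hα : 0 ≤ α) (hq0 : 0 ≤ q) (hq1 : q ≤ 1) (M M' : ℕ) (hMM' : M + M' = n) (hle : M ≤ M')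
    (hle' : M' ≤ M + 1) :
    ∑ j ∈ Finset.range n, |α * (q ^ j + q ^ (n - j)) - α * (q ^ (j + 1) + q ^ (n - (j + 1)))| =
      2 * α * ((1 - q ^ M) * (1 - q ^ M')) := by
  set G : ℕ → ℝ := fun j => α * (q ^ j + q ^ (n - j)) with hG
  show ∑ j ∈ Finset.range n, |G j - G (j + 1)| = _
  have hdiff : ∀ j, j < n → G j - G (j + 1) = α * (1 - q) * (q ^ j - q ^ (n - 1 - j)) := by
    intro j hj
    simp only [hG]
    rw [show n - j = (n - 1 - j) + 1 by omega, pow_succ, show n - (j + 1) = n - 1 - j by omega, pow_succ]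
    ring
  have hdec : ∀ j, j < M → 0 ≤ G j - G (j + 1) := by
    intro j hj
    rw [hdiff j (by omega)]
    have : q ^ (n - 1 - j) ≤ q ^ j := pow_le_pow_of_le_one hq0 hq1 (by omega)
    exact mul_nonneg (mul_nonneg hα (by linarith)) (by linarith)
  have hinc : ∀ j, M ≤ j → j < n → G j - G (j + 1) ≤ 0 := by
    intro j hj hjn
    rw [hdiff j hjn]
    have : q ^ j ≤ q ^ (n - 1 - j) := pow_le_pow_of_le_one hq0 hq1 (by omega)
    exact mul_nonpos_iff.2 (Or.inl ⟨mul_nonneg hα (by linarith), by linarith⟩)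
  have h1 : ∑ j ∈ Finset.range M, |G j - G (j + 1)| = G 0 - G M := by
    have hc : ∀ j ∈ Finset.range M, |G j - G (j + 1)| = G j - G (j + 1) := fun j hj =>
      abs_of_nonneg (hdec j (Finset.mem_range.1 hj))
    rw [Finset.sum_congr rfl hc, Finset.sum_range_sub']
  have h2 : ∑ j ∈ Finset.Ico M n, |G j - G (j + 1)| = G n - G M := by
    have hc : ∀ j ∈ Finset.Ico M n, |G j - G (j + 1)| = G (j + 1) - G j := fun j hj => by
      rw [Finset.mem_Ico] at hj
      rw [abs_of_nonpos (hinc j hj.1 hj.2), neg_sub]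
    rw [Finset.sum_congr rfl hc, Finset.sum_Ico_eq_sum_range]
    have e := Finset.sum_range_sub (fun i => G (M + i)) (n - M)
    rw [show M + (n - M) = n by omega, add_zero] at e
    rw [← e]
    exact Finset.sum_congr rfl fun i _ => by rw [add_assoc]
  rw [← Finset.sum_range_add_sum_Ico _ (show M ≤ n by omega), h1, h2]
  have hGn : G n = G 0 := by simp only [hG, Nat.sub_zero, Nat.sub_self, pow_zero]; ring
  rw [hGn]
  simp only [hG, pow_zero, Nat.sub_zero, show n - M = M' by omega]
  rw [show q ^ n = q ^ M * q ^ M' by rw [← pow_add, hMM']]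
  ring

/-- **THE ∇-ROW OF THE CYCLE RESOLVENT IN CLOSED FORM**: for `2 ≤ n`, `t ≠ 0`, `m > 0`, the root `q ∈ (0,1)` of `q + q⁻¹ = 2 + m∕t²`
and the solution `φ` of `t²[(φ(s) − φ(s−1)) + (φ(s) − φ(s+1))] + m·φ(s) = δ_{s,0}` on `ℤ∕n` (`n = M + M′`, `M ≤ M′ ≤ M + 1`):
`Σ_s |φ(s−1) − φ(s)| = (2q∕(t²(1−q²)))·(1 − q^M)(1 − q^{M′})∕(1 − q^{M+M′})` — increasing to the line value `2q∕(t²(1−q²)) = 2∕√(m²+4mt²)`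
as `n → ∞`. [folklore] [cite: Balaban1984PropagatorsI, (1.29) p.23] -/
theorem sum_abs_sub_eq (hn : 2 ≤ n) (t : ℝ) (ht : t ≠ 0) {m : ℝ} (hm : 0 < m) {q : ℝ} (hq0 : 0 < q) (hq1 : q < 1)
    (hq : q + q⁻¹ = 2 + m / t ^ 2) {φ : ZMod n → ℝ}
    (hφ : ∀ s, t ^ 2 * ((φ s - φ (s - 1)) + (φ s - φ (s + 1))) + m * φ s = if s = 0 then 1 else 0)
    (M M' : ℕ) (hMM' : M + M' = n) (hle : M ≤ M') (hle' : M' ≤ M + 1) :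
    ∑ s : ZMod n, |φ (s - 1) - φ s| = 2 * q / (t ^ 2 * (1 - q ^ 2)) * ((1 - q ^ M) * (1 - q ^ M') / (1 - q ^ (M + M'))) := by
  haveI : Fact (1 < n) := ⟨by omega⟩
  have hval1 : (1 : ZMod n).val = 1 := ZMod.val_one _
  have ht2 : 0 < t ^ 2 := by positivity
  have hq2 : 0 < 1 - q ^ 2 := by nlinarith
  have hqn : 0 < 1 - q ^ (M + M') := by have := pow_lt_one₀ hq0.le hq1 (by omega : M + M' ≠ 0); linarith
  have hqn' : 0 < 1 - q ^ n := by have := pow_lt_one₀ hq0.le hq1 (by omega : n ≠ 0); linarith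
  set α : ℝ := q / (t ^ 2 * (1 - q ^ 2) * (1 - q ^ n)) with hαdef
  have hαnn : 0 ≤ α := div_nonneg hq0.le (mul_nonneg (mul_nonneg ht2.le hq2.le) hqn'.le)
  have hprof := cycle_profile_eq hn t ht hm hq0 hq1 hq hφ
  rw [sum_cycle_eq_sum_range]
  have hterm : ∀ j ∈ Finset.range n, |φ ((j : ZMod n) + 1 - 1) - φ ((j : ZMod n) + 1)| =
      |α * (q ^ j + q ^ (n - j)) - α * (q ^ (j + 1) + q ^ (n - (j + 1)))| := by
    intro j hj
    rw [Finset.mem_range] at hj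
    have hvj : (j : ZMod n).val = j := by rw [ZMod.val_natCast, Nat.mod_eq_of_lt hj]
    rw [add_sub_cancel_right, hprof, hprof, hvj]
    congr 2
    by_cases hlt : j + 1 < n
    · rw [ZMod.val_add_of_lt (by rw [hvj, hval1]; exact hlt), hvj, hval1]
    · have hj1 : j + 1 = n := by omega
      have h0 : (j : ZMod n) + 1 = 0 := by rw [← Nat.cast_succ, show j.succ = n by omega, ZMod.natCast_self]
      rw [h0, ZMod.val_zero, hj1, pow_zero, Nat.sub_zero, Nat.sub_self, pow_zero]
      ring
  rw [Finset.sum_congr rfl hterm, tv_range α q hαnn hq0.le hq1.le M M' hMM' hle hle', hαdef,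
    show q ^ n = q ^ (M + M') by rw [hMM']]
  simp only [div_eq_mul_inv, mul_inv]
  ring

/-- `(1 − a)(1 − b) ≤ 1 − ab` on the unit square. [folklore] -/
private theorem one_sub_mul_one_sub_le {a b : ℝ} (ha0 : 0 ≤ a) (ha1 : a ≤ 1) (hb0 : 0 ≤ b) (hb1 : b ≤ 1) :
    (1 - a) * (1 - b) ≤ 1 - a * b := by nlinarith [mul_nonneg ha0 (sub_nonneg.2 hb1), mul_nonneg hb0 (sub_nonneg.2 ha1)]

/-- **THE UNIVERSAL BOUND OF THE ∇-ROW ON THE CYCLE**: `Σ_s |φ(s−1) − φ(s)| ≤ 2∕√(m² + 4mt²)` for the cycle resolvent (`2 ≤ n`, `t ≠ 0`,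
`m > 0`) — uniformly in the period `n`; at `t = η⁻¹`, `m = 1` this is `η·S₁ ≤ 2η∕√(η² + 4)`, i.e. the η⁻¹-normalised row `S₁ ≤ 2∕√(4 + η²) < 1`.
[folklore] [cite: Balaban1984PropagatorsI, (1.29) p.23] -/
theorem sum_abs_sub_le (hn : 2 ≤ n) (t : ℝ) (ht : t ≠ 0) {m : ℝ} (hm : 0 < m) {φ : ZMod n → ℝ}
    (hφ : ∀ s, t ^ 2 * ((φ s - φ (s - 1)) + (φ s - φ (s + 1))) + m * φ s = if s = 0 then 1 else 0) :
    ∑ s : ZMod n, |φ (s - 1) - φ s| ≤ 2 / Real.sqrt (m ^ 2 + 4 * m * t ^ 2) := by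
  obtain ⟨q, hq0, hq1, hq⟩ := exists_root t ht hm
  obtain ⟨M, M', hMM', hle, hle'⟩ : ∃ M M' : ℕ, M + M' = n ∧ M ≤ M' ∧ M' ≤ M + 1 := ⟨n / 2, n - n / 2, by omega, by omega, by omega⟩
  rw [sum_abs_sub_eq hn t ht hm hq0 hq1 hq hφ M M' hMM' hle hle', root_const_eq t ht hm hq0 hq1 hq]
  have hs : 0 < 2 / Real.sqrt (m ^ 2 + 4 * m * t ^ 2) := div_pos two_pos (Real.sqrt_pos.2 (by positivity))
  have hqn : 0 < 1 - q ^ (M + M') := by have := pow_lt_one₀ hq0.le hq1 (by omega : M + M' ≠ 0); linarith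
  have hfrac : (1 - q ^ M) * (1 - q ^ M') / (1 - q ^ (M + M')) ≤ 1 := by
    rw [div_le_one hqn, pow_add]
    exact one_sub_mul_one_sub_le (pow_nonneg hq0.le _) (pow_le_one₀ hq0.le hq1.le) (pow_nonneg hq0.le _)
      (pow_le_one₀ hq0.le hq1.le)
  calc 2 / Real.sqrt (m ^ 2 + 4 * m * t ^ 2) * ((1 - q ^ M) * (1 - q ^ M') / (1 - q ^ (M + M')))
      ≤ 2 / Real.sqrt (m ^ 2 + 4 * m * t ^ 2) * 1 := mul_le_mul_of_nonneg_left hfrac hs.le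
    _ = _ := mul_one _

end Literature.MathematicalPhysics.QuantumFieldTheory.Balaban1983to89.B5Eq129FreeResolventCycleProfile

end
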